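import Summits.QuantumFields.YangMills.Theorems.BalabanUVNodesN26AtRecord11
import Literature.MathematicalPhysics.QuantumFieldTheory.Balaban1983to89.Node00.Record13
import Literature.MathematicalPhysics.QuantumFieldTheory.Balaban1983to89.Node00.Record13SepCoPH
import Literature.MathematicalPhysics.QuantumFieldTheory.Balaban1983to89.T4CouplingMatching
import Summits.QuantumFields.BalabanUV.Gaps.CapSignsConstRoad
import Summits.QuantumFields.BalabanUV.Gaps.D1Residue
import Summits.QuantumFields.BalabanUV.Gaps.EndDrawdownEverySlope
import Summits.QuantumFields.YangMills.Theses.BalabanUVNodes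

/-!
# Sketch — crux idea `shift-cauchy-everyslope` for K2⁷ `EndpointGivenBR13SepCoPH` (stmt-QuantumFields-20543), seat ym-nodeO-idea-7 (lens: inversion)

FIRST LEMMA (kernel-checked here, generic over the tree's carriers): the T4 spine's remainder SHIFT-RATE (`T4CouplingMatching.RemainderShiftRate`,
uniform Cauchy-ness of `β¹` along the scale ladder) + a PER-SCALE anchor (`AnchorVanishing`: each `β¹_k → 0` at the zero history, constants free
in `k`) ⟹ `CapSignsConstRoad.EverySlope` (row (D4)'s currency) — a Moore–Osgood ∕ Dini interchange, summed as a telescoping series.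
COMPOSITION: with row (D1)'s `Residue` and box continuity, `D1Residue.endpointExistence_of_residue` BY NAME gives `EndpointExistence`;
at NODE 00's Stage-13 record this yields the crux decl from four named `Prop`s (`EndpointGivenBR13SepCoPH_of_shiftCauchy`, no sorry).
Nothing of Bałaban's is asserted; the four record-level `Prop`s are hypothesis SHAPES.  YM mass gap (Clay) is NOT proved by any of this;
R4 closes only the conditional finite-𝕋⁴ rung `BalabanLadder.UV`.
-/

noncomputable section

open scoped Matrix.Norms.L2Operator
open Finset

namespace Summit.QuantumFields.YangMills.Cruxes.EndpointGivenBR13SepCoPH.ShiftCauchy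

open Literature.MathematicalPhysics.QuantumFieldTheory.Balaban1983to89
open Literature.MathematicalPhysics.QuantumFieldTheory.Balaban1983to89.FlowStep
open Literature.MathematicalPhysics.QuantumFieldTheory.Balaban1983to89.DagBinding (EndpointExistence ForwardGenerated)
open Literature.MathematicalPhysics.QuantumFieldTheory.Balaban1983to89.T4Continuum (T4Family)
open Literature.MathematicalPhysics.QuantumFieldTheory.Balaban1983to89.T4CouplingMatching (RemainderShiftRate)
open Literature.MathematicalPhysics.QuantumFieldTheory.Balaban1983to89.T4FlagMemory (tail_mem_box)
open Literature.MathematicalPhysics.QuantumFieldTheory.Balaban1983to89.Beta.RemainderChain (RemainderConst)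
open Literature.MathematicalPhysics.QuantumFieldTheory.Balaban1983to89.Node00
open Literature.MathematicalPhysics.QuantumFieldTheory.Balaban1983to89.Beta.OneStepKernelFamily (TbalOf)
open Literature.MathematicalPhysics.QuantumFieldTheory.Balaban1983to89.Beta.OneStepResolventKernel (JetData)
open Summit.QuantumFields.BalabanUV.Gaps
open Summit.QuantumFields.BalabanUV.Gaps.CapSignsConstRoad (EverySlope)

/-! ## §1 Generic real analysis over the tree's carriers -/

/-- PER-SCALE ANCHOR (no uniformity in `k`): each remainder `β¹_k` is small near the zero history, `∀ k δ>0 ∃ γ>0, |β¹_k| ≤ δ` on `]0,γ]^{k+1}`.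
Printed locus: [Balaban1987RG1] (2.13) p. 268 «vanishes at g_k = 0», read scale by scale. A hypothesis SHAPE, never a fact. -/
def AnchorVanishing {β : HBeta} (S : B12Beta.OneLoopSplit β) : Prop :=
  ∀ k : ℕ, ∀ δ : ℝ, 0 < δ → ∃ γ : ℝ, 0 < γ ∧ ∀ v ∈ Box γ k, |S.β1 k v| ≤ δ

/-- finitely many scales at once (min of finitely many positive radii). [folklore] -/
theorem anchor_upTo {β : HBeta} (S : B12Beta.OneLoopSplit β) (hA : AnchorVanishing S) (k₀ : ℕ) {δ : ℝ} (hδ : 0 < δ) :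
    ∃ γ : ℝ, 0 < γ ∧ ∀ k, k ≤ k₀ → ∀ v ∈ Box γ k, |S.β1 k v| ≤ δ := by
  induction k₀ with
  | zero =>
    obtain ⟨γ, hγ, h⟩ := hA 0 δ hδ
    refine ⟨γ, hγ, fun k hk v hv => ?_⟩
    obtain rfl := Nat.le_zero.mp hk
    exact h v hv
  | succ n ih =>
    obtain ⟨γ, hγ, h⟩ := ih
    obtain ⟨γ', hγ', h'⟩ := hA (n + 1) δ hδ
    refine ⟨min γ γ', lt_min hγ hγ', fun k hk v hv => ?_⟩
    rcases Nat.lt_or_ge k (n + 1) with hlt | hge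
    · exact h k (Nat.lt_succ_iff.mp hlt) v (box_mono (min_le_left _ _) k hv)
    · obtain rfl := le_antisymm hk hge
      exact h' v (box_mono (min_le_right _ _) _ hv)

/-- TELESCOPING ALONG THE LADDER: from a bound `b` at depth `k₀` on `]0,γ]^{k₀+1}` (γ ≤ γ₁) and the shift-rate on `]0,γ₁]`-boxes,
`|β¹_{k₀+m}(v)| ≤ b + Σ_{j<m} c₁ θ^{k₀+j}` on `]0,γ]^{k₀+m+1}` (peel the UV-most coordinate with `Fin.tail`). [folklore] -/
theorem shift_iterate {β : HBeta} (S : B12Beta.OneLoopSplit β) {c₁ θ γ₁ γ : ℝ} (hshift : RemainderShiftRate S c₁ θ γ₁)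
    (hγ : γ ≤ γ₁) (k₀ : ℕ) {b : ℝ} (hbase : ∀ v ∈ Box γ k₀, |S.β1 k₀ v| ≤ b) :
    ∀ m : ℕ, ∀ v ∈ Box γ (k₀ + m), |S.β1 (k₀ + m) v| ≤ b + ∑ j ∈ range m, c₁ * θ ^ (k₀ + j) := by
  intro m
  induction m with
  | zero => intro v hv; simpa using hbase v hv
  | succ m ih =>
    intro v hv
    have hv₁ : v ∈ Box γ₁ (k₀ + m + 1) := box_mono hγ _ hv
    have hs : |S.β1 (k₀ + m + 1) v - S.β1 (k₀ + m) (Fin.tail v)| ≤ c₁ * θ ^ (k₀ + m) := hshift (k₀ + m) v hv₁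
    have ht : |S.β1 (k₀ + m) (Fin.tail v)| ≤ b + ∑ j ∈ range m, c₁ * θ ^ (k₀ + j) := ih (Fin.tail v) (tail_mem_box hv)
    have htri : |S.β1 (k₀ + m + 1) v| - |S.β1 (k₀ + m) (Fin.tail v)| ≤ |S.β1 (k₀ + m + 1) v - S.β1 (k₀ + m) (Fin.tail v)| :=
      abs_sub_abs_le_abs_sub _ _
    rw [Finset.sum_range_succ]
    show |S.β1 (k₀ + m + 1) v| ≤ b + (∑ j ∈ range m, c₁ * θ ^ (k₀ + j) + c₁ * θ ^ (k₀ + m))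
    linarith

/-- geometric tail. [folklore] -/
theorem geom_tail_le {θ : ℝ} (hθ0 : 0 ≤ θ) (hθ1 : θ < 1) (m : ℕ) : ∑ j ∈ range m, θ ^ j ≤ (1 - θ)⁻¹ := by
  have h1 : 0 < 1 - θ := by linarith
  rw [geom_sum_eq hθ1.ne m]
  have : (θ ^ m - 1) / (θ - 1) = (1 - θ ^ m) / (1 - θ) := by
    rw [show θ - 1 = -(1 - θ) by ring, show θ ^ m - 1 = -(1 - θ ^ m) by ring, neg_div_neg_eq]
  rw [this, inv_eq_one_div]
  have hp : 0 ≤ θ ^ m := pow_nonneg hθ0 m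
  gcongr
  linarith

/-- **FIRST LEMMA (the lever): shift-rate + per-scale anchor ⟹ `EverySlope`.**  Given `s > 0`: pick `k₀` with `c₁θ^{k₀}/(1−θ) ≤ s/2`
(tail), a radius for the finitely many scales `k ≤ k₀` at tolerance `s/2` (anchor), and telescope for `k > k₀`. [folklore] -/
theorem everySlope_of_shiftRate_anchor {β : HBeta} (S : B12Beta.OneLoopSplit β) {c₁ θ γ₁ : ℝ} (hγ₁ : 0 < γ₁) (hc₁ : 0 ≤ c₁)
    (hθ0 : 0 ≤ θ) (hθ1 : θ < 1) (hshift : RemainderShiftRate S c₁ θ γ₁) (hA : AnchorVanishing S) : EverySlope S γ₁ := by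
  intro s hs
  have h1 : 0 < 1 - θ := by linarith
  set ε : ℝ := s / 2 * (1 - θ) / (c₁ + 1) with hε
  have hεpos : 0 < ε := by positivity
  obtain ⟨k₀, hk₀⟩ := exists_pow_lt_of_lt_one hεpos hθ1
  obtain ⟨γa, hγa, ha⟩ := anchor_upTo S hA k₀ (half_pos hs)
  refine ⟨min γ₁ γa, lt_min hγ₁ hγa, min_le_left _ _, ?_⟩
  intro k p hp
  rw [histBox_eq_box] at hp
  rcases Nat.lt_or_ge k₀ k with hk | hk
  · obtain ⟨m, rfl⟩ := Nat.exists_eq_add_of_le hk.le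
    have hiter := shift_iterate S hshift (min_le_left γ₁ γa) k₀ (b := s / 2)
      (fun v hv => ha k₀ le_rfl v (box_mono (min_le_right _ _) _ hv)) m p hp
    have htail : ∑ j ∈ range m, c₁ * θ ^ (k₀ + j) ≤ s / 2 := by
      have hsum : ∑ j ∈ range m, c₁ * θ ^ (k₀ + j) = c₁ * θ ^ k₀ * ∑ j ∈ range m, θ ^ j := by
        rw [Finset.mul_sum]
        refine Finset.sum_congr rfl fun j _ => ?_
        rw [pow_add]; ring
      rw [hsum]
      have hpk : 0 ≤ θ ^ k₀ := pow_nonneg hθ0 k₀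
      calc c₁ * θ ^ k₀ * ∑ j ∈ range m, θ ^ j
          ≤ c₁ * θ ^ k₀ * (1 - θ)⁻¹ := by
            exact mul_le_mul_of_nonneg_left (geom_tail_le hθ0 hθ1 m) (mul_nonneg hc₁ hpk)
        _ ≤ (c₁ + 1) * ε * (1 - θ)⁻¹ := by
            apply mul_le_mul_of_nonneg_right _ (inv_nonneg.mpr h1.le)
            calc c₁ * θ ^ k₀ ≤ (c₁ + 1) * θ ^ k₀ := by nlinarith
              _ ≤ (c₁ + 1) * ε := by
                exact mul_le_mul_of_nonneg_left hk₀.le (by linarith)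
        _ = s / 2 := by
            rw [hε]; field_simp
    linarith
  · exact (ha k hk p (box_mono (min_le_right _ _) k hp)).trans (half_le_self hs.le)

/-- **END on the every-slope road from the shift-rate line** (abstract construction level): row (D1)'s `Residue` pinned on the split's one-loop
numbers, a positive slope, the shift-rate + anchor, and box continuity ⟹ `EndpointExistence` — `D1Residue.endpointExistence_of_residue` BY NAME at the
box `EverySlope` returns for `s := stepBal N Lc`.  (U)-free, no certified numeral, no (190)-chain. [folklore] -/
theorem endpointExistence_of_residue_shiftRate_anchor {Lc : ℕ} [NeZero Lc] {β : HBeta} {Cn : B12.Construction}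
    (hgen : ForwardGenerated Cn β) (Sβ : B12Beta.OneLoopSplit β) (Js : ℕ → JetData 3 Lc) {N : ℝ} {μ ν : Fin 4}
    (hβ : ∀ j, Sβ.β0 j = B12Beta.secondMoment (TbalOf Lc Js j) μ ν) (h : D1Residue.Residue Lc Js N μ ν)
    (hslope : 0 < B12Normalization.stepBal N Lc) {c₁ θ γ₁ : ℝ} (hγ₁ : 0 < γ₁) (hc₁ : 0 ≤ c₁) (hθ0 : 0 ≤ θ) (hθ1 : θ < 1)
    (hshift : RemainderShiftRate Sβ c₁ θ γ₁) (hA : AnchorVanishing Sβ) (hcont : BetaContH γ₁ β) : EndpointExistence Cn := by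
  obtain ⟨γ, hγ, hγle, hrem⟩ := everySlope_of_shiftRate_anchor Sβ hγ₁ hc₁ hθ0 hθ1 hshift hA _ hslope
  exact D1Residue.endpointExistence_of_residue hgen Sβ Js hβ h hγ hrem le_rfl (fun k => (hcont k).mono (box_mono hγle k))

/-! ## §2 The line at NODE 00's Stage-13 record (hypothesis SHAPES; composition to the crux decl BY NAME) -/

/-- = the registered K2 skeleton's `D1AtRecord13` VERBATIM (shared stub `stub_d1Residue13`, row (D1)). -/
def D1AtRecord13 : Prop :=
  ∀ (F : T4Family) (θ : Node00.Stage13HParams F 2) (hP : θ.Provisos₁₃SepCoPH F 2), θ.Admissible F 2 →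
    letI := θ.instVβ₁; letI := θ.instVβ₂; letI := θ.instιβ
    ∃ (Lc : ℕ) (_ : NeZero Lc) (Js : ℕ → JetData 3 Lc) (Nc : ℝ),
      (∀ j, beta0OfMerged (betaMerged F (mergedTermFamilyMatT F 2 (TcanOfRecord F 2) (chiFixed29 F 2 θ.ν θ.ε₂₉) θ.εbg) θ.ρ8 θ.bV) θ.v₀ j =
          B12Beta.secondMoment (TbalOf Lc Js j) 0 1) ∧
      D1Residue.Residue Lc Js Nc 0 1

/-- STUB SHAPE S0 «the flat-corner guard» (shared exposure with the registered `D4AtSlopeOfD1Record13`, an4 g148 census): every (D1) datum pinned on the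
record's one-loop numbers has POSITIVE slope `stepBal Nc Lc` — asymptotic freedom's sign, row (D1)'s business (a degenerate witness `Nc = 0` kills this line
exactly as it kills the registered one, `historyFree_of_d4Stub_flatDatum`). -/
def SlopePosOfD1Record13 : Prop :=
  ∀ (F : T4Family) (θ : Node00.Stage13HParams F 2) (hP : θ.Provisos₁₃SepCoPH F 2), θ.Admissible F 2 →
    letI := θ.instVβ₁; letI := θ.instVβ₂; letI := θ.instιβ
    ∀ (Lc : ℕ) (_ : NeZero Lc) (Js : ℕ → JetData 3 Lc) (Nc : ℝ),
      (∀ j, beta0OfMerged (betaMerged F (mergedTermFamilyMatT F 2 (TcanOfRecord F 2) (chiFixed29 F 2 θ.ν θ.ε₂₉) θ.εbg) θ.ρ8 θ.bV) θ.v₀ j =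
          B12Beta.secondMoment (TbalOf Lc Js j) 0 1) →
      D1Residue.Residue Lc Js Nc 0 1 → 0 < B12Normalization.stepBal Nc Lc

/-- NEW STUB SHAPE S1 «shift-rate of the record's remainder» (replaces the (190)-chain inhabitant of `D4AtSlopeOfD1Record13`): the record's definitional
split has `RemainderShiftRate c₁ ϑ γ₁` on some `]0,γ₁] ⊆ ]0,θ.γ]` with `0 ≤ c₁`, `0 ≤ ϑ < 1` — the T4 uniqueness spine's NE4 remainder half for the SAME β
(`T4CouplingMatching.RemainderShiftRate`; cell T4-DAG §6; GAPS G-t4-U2-1: NOT PRINTED). -/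
def D4ShiftRateRecord13 : Prop :=
  ∀ (F : T4Family) (θ : Node00.Stage13HParams F 2) (hP : θ.Provisos₁₃SepCoPH F 2), θ.Admissible F 2 →
    letI := θ.instVβ₁; letI := θ.instVβ₂; letI := θ.instιβ
    ∃ c₁ ϑ γ₁ : ℝ, 0 ≤ c₁ ∧ 0 ≤ ϑ ∧ ϑ < 1 ∧ 0 < γ₁ ∧ γ₁ ≤ θ.γ ∧
      RemainderShiftRate
        (oneLoopSplit_betaOfMerged (betaMerged F (mergedTermFamilyMatT F 2 (TcanOfRecord F 2) (chiFixed29 F 2 θ.ν θ.ε₂₉) θ.εbg) θ.ρ8 θ.bV)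
        (beta0OfMerged (betaMerged F (mergedTermFamilyMatT F 2 (TcanOfRecord F 2) (chiFixed29 F 2 θ.ν θ.ε₂₉) θ.εbg) θ.ρ8 θ.bV) θ.v₀) θ.γ)
        c₁ ϑ γ₁

/-- NEW STUB SHAPE S2 «per-scale anchor of the record's remainder»: `AnchorVanishing` of the record's definitional split — each `β¹_k → 0` at the zero
history, constants free in `k` ([Balaban1987RG1] (2.13) p. 268 read at fixed `k`; fixed-cutoff grade). -/
def D4AnchorRecord13 : Prop :=
  ∀ (F : T4Family) (θ : Node00.Stage13HParams F 2) (hP : θ.Provisos₁₃SepCoPH F 2), θ.Admissible F 2 →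
    letI := θ.instVβ₁; letI := θ.instVβ₂; letI := θ.instιβ
    AnchorVanishing
      (oneLoopSplit_betaOfMerged (betaMerged F (mergedTermFamilyMatT F 2 (TcanOfRecord F 2) (chiFixed29 F 2 θ.ν θ.ε₂₉) θ.εbg) θ.ρ8 θ.bV)
        (beta0OfMerged (betaMerged F (mergedTermFamilyMatT F 2 (TcanOfRecord F 2) (chiFixed29 F 2 θ.ν θ.ε₂₉) θ.εbg) θ.ρ8 θ.bV) θ.v₀) θ.γ)

/-- STUB SHAPE S3 «box continuity of the record's β» (the (C) binder; the registered line takes it from the chain's leaves `CPt`, the T4 spine from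
`HistLipschitz` via `T4BetaStationary.betaContH_of_histLipschitz`): `BetaContH θ.γ` of the record's β, scale by scale (no uniformity). -/
def ContRecord13 : Prop :=
  ∀ (F : T4Family) (θ : Node00.Stage13HParams F 2) (hP : θ.Provisos₁₃SepCoPH F 2), θ.Admissible F 2 →
    letI := θ.instVβ₁; letI := θ.instVβ₂; letI := θ.instιβ
    BetaContH θ.γ
      (betaOfMerged (betaMerged F (mergedTermFamilyMatT F 2 (TcanOfRecord F 2) (chiFixed29 F 2 θ.ν θ.ε₂₉) θ.εbg) θ.ρ8 θ.bV)
        (beta0OfMerged (betaMerged F (mergedTermFamilyMatT F 2 (TcanOfRecord F 2) (chiFixed29 F 2 θ.ν θ.ε₂₉) θ.εbg) θ.ρ8 θ.bV) θ.v₀) θ.γ)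

/-- **THE COMPOSITION AT THE RECORD (kernel-checked, no sorry): (D1) stub → S0 → S1 → S2 → S3 → the crux decl `EndpointGivenBR13SepCoPH` BY NAME**,
through `endpointExistence_of_residue_shiftRate_anchor` at the datum of record (`.fwd` = forward generation; the split = `Node00.oneLoopSplit_betaOfMerged`,
definitionally the datum's β; continuity restricted from `]0,θ.γ]` to `]0,γ₁]` by `box_mono`). -/
theorem EndpointGivenBR13SepCoPH_of_shiftCauchy (h₁ : D1AtRecord13) (h₀ : SlopePosOfD1Record13) (h₂ : D4ShiftRateRecord13)
    (h₃ : D4AnchorRecord13) (h₄ : ContRecord13) :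
    Summit.QuantumFields.YangMills.Theses.BalabanUVNodes.EndpointGivenBR13SepCoPH := by
  intro F θ hP _hU hθ _hB _hwin
  letI := θ.instVβ₁; letI := θ.instVβ₂; letI := θ.instιβ
  obtain ⟨Lc, _, Js, Nc, hβ, h1⟩ := h₁ F θ hP hθ
  have hslope := h₀ F θ hP hθ Lc inferInstance Js Nc hβ h1
  obtain ⟨c₁, ϑ, γ₁, hc₁, hϑ0, hϑ1, hγ₁, hγ₁le, hshift⟩ := h₂ F θ hP hθ
  have hA := h₃ F θ hP hθ
  have hcont := h₄ F θ hP hθ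
  exact endpointExistence_of_residue_shiftRate_anchor (Node00.datumOfRecord₁₃SepCoPH F 2 θ hP).fwd
    (oneLoopSplit_betaOfMerged _ _ _) Js (fun j => hβ j) h1 hslope hγ₁ hc₁ hϑ0 hϑ1 hshift hA
    (fun k => (hcont k).mono (box_mono hγ₁le k))

/-! ## §3 Cheapest falsifier F1, RUN: the cell's toy `splitN` (`EndDrawdownEverySlope` §4: EverySlope ✓, END ✗, drift slope 0) satisfies S1-shape and
S2-shape — so S1 ∧ S2 alone decide nothing and the slope guard S0 ∕ the (D1) drift is load-bearing, exactly as the card states (consistency, not a kill). -/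

open Summit.QuantumFields.BalabanUV.Gaps.EndDrawdownEverySlope (betaN splitN betaN_of_pos not_endpointExistence_betaN)

/-- `splitN` has the shift-rate with constant `c₁ = 0` (its remainder reads only the last coupling, which `Fin.tail` preserves). [folklore] -/
theorem remainderShiftRate_splitN (θ γ : ℝ) : RemainderShiftRate splitN 0 θ γ := by
  intro k w hw
  have hl : 0 < w (Fin.last (k + 1)) := ((mem_box.mp hw) (Fin.last (k + 1))).1
  have hl' : 0 < Fin.tail w (Fin.last k) := by
    show 0 < w (Fin.last k).succ
    rw [Fin.succ_last]; exact hl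
  have h1 : splitN.β1 (k + 1) w = -(w (Fin.last (k + 1))) := betaN_of_pos (k + 1) hl
  have h2 : splitN.β1 k (Fin.tail w) = -(Fin.tail w (Fin.last k)) := betaN_of_pos k hl'
  have h3 : Fin.tail w (Fin.last k) = w (Fin.last (k + 1)) := by
    show w (Fin.last k).succ = _
    rw [Fin.succ_last]
  rw [h1, h2, h3, sub_self, abs_zero, zero_mul]

/-- `splitN` has the per-scale anchor (`|β¹_k| ≤ γ` on `]0,γ]^{k+1}`). [folklore] -/
theorem anchorVanishing_splitN : AnchorVanishing splitN := by
  intro k δ hδ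
  refine ⟨δ, hδ, fun v hv => ?_⟩
  have h := (mem_box.mp hv) (Fin.last k)
  show |betaN k v| ≤ δ
  rw [betaN_of_pos k h.1, abs_neg, abs_of_pos h.1]
  exact h.2

/-- F1 verdict in the kernel: S1-shape ∧ S2-shape hold for `splitN`, yet `modelOf betaN` has NO endpoint — the missing input is the positive slope
(`splitN.β0 ≡ 0`), i.e. S0 ∕ (D1).  [folklore] -/
theorem f1_consistency : RemainderShiftRate splitN 0 (1 / 2) 1 ∧ AnchorVanishing splitN ∧ ¬ EndpointExistence (FlowStepRuns.modelOf betaN) :=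
  ⟨remainderShiftRate_splitN _ _, anchorVanishing_splitN, not_endpointExistence_betaN⟩

end Summit.QuantumFields.YangMills.Cruxes.EndpointGivenBR13SepCoPH.ShiftCauchy

end
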